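import Summits.BirchSwinnertonDyer.BirchSwinnertonDyer.Theorems.SignedLowerHalvesKobayashiLowerHalfSemistableDefmuOddPrimeFrame
import HarnessLib

/-!
# Line «defmu» of crux 2 `KobayashiLowerHalfSemistable` (stmt-BirchSwinnertonDyer-19000) AT AN ODD PRIME — part 2/3: the descent
# S5ʳ (period unit from Mazur Cor. 4.1) and the package ⟹ lower-divisibility assembly at any odd `p` with `a_p = 0`

Route-independent `Theorems` file of the cell `bsd-ssimc`, seat `bsd-line-slh-p2` (LEAD of crux 2, gen 18); part 2 of the «defmu at an odd
prime» series (part 1: `…DefmuOddPrimeFrame.lean`; part 3: `…DefmuOddPrimeThree.lean`). HONEST FRAMING: nothing about any curve is asserted, NO summit statement is proved, BSD / the crux is NOT proved; every theorem is an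
IMPLICATION from hypotheses displayed in full.

THIS PART: `kobayashiMainConjecture_of_twoVariableDvd_odd` — the descent S5ʳ at any odd `p`: p629660 §2 VERBATIM except that the Néron
normalisation step takes the period unit from Mazur 1978 Cor. 4.1 BY NAME (`SkinnerUrban2014.exists_unit_mul_plusPeriod_of_irreducible_of_mazur`,
`p ≠ 2`, `p² ∤ N_W` from good reduction) instead of the `5 ≤ p` fact `realPeriodRat_eq_unit_mul_plusPeriod`;
`exists_kobayashiLowerDivisibility_odd_of_package` — p629660 §3 at any odd `p` with `a_p = 0`, with BSTW Thm 6.17 AT ODD `p` as a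
DISPLAYED HYPOTHESIS `h617` (the text of the tree's binder `thm617_exists_isGreenbergLFunctionAnyRoot₂_supersingular_PRE` with `5 ≤ p`
replaced by `p ≠ 2`; print states Thm 6.17 for `p ∤ 2N` with (h4) `a_p = 0` at `p = 3`; at `p = 3` this is an UNTYPED PREPRINT CLAIM and
exactly where the cell's referees located the `p = 3` residual (3-ii)♭′ (bstw-MEMO-10) — NOT asserted here).

References: [BurungaleSkinnerTianWan2024] arXiv:2409.01350v2 Thm. 6.17 (hypotheses §1.2), Thm. 9.24, §2.3; [Kobayashi2003] Thms. 1.2, 4.1;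
[Mazur1978] Cor. 4.1; [PollackWeston2011] Thm. 2.5.
-/

-- D-0017: single-problem summit, the namespace repeats the problem name by design.
set_option linter.dupNamespace false
set_option autoImplicit false

noncomputable section

open scoped Classical

open NumberField IsDedekindDomain Field CongruenceSubgroup
open Literature.NumberTheory.GaloisRepresentations
open Literature.NumberTheory.EllipticCurves Literature.NumberTheory.EllipticCurves.BurungaleSkinnerTianWan2024
open Literature.NumberTheory.EllipticCurves.ModularForms
open Literature.NumberTheory.Automorphic
open Summit.BirchSwinnertonDyer.BirchSwinnertonDyer.Theorems.SignedBaseChangeK1FrameData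
open Summit.BirchSwinnertonDyer.BirchSwinnertonDyer.Theorems.SignedBaseChangeK2RTransferDescent
open Summit.BirchSwinnertonDyer.BirchSwinnertonDyer.Theorems.SemistableDefmuAssembly

namespace Summit.BirchSwinnertonDyer.BirchSwinnertonDyer.Theorems.SemistableDefmuOddPrime

/-! ### §2. The descent S5ʳ at any odd prime (period unit from Mazur Cor. 4.1) -/

open scoped MatrixGroups ModularForm in
open WeierstrassCurve Literature.NumberTheory.EllipticCurves.Rank1Residual
  Literature.NumberTheory.EllipticCurves.BurungaleCastellaSkinner2025
  Literature.NumberTheory.EllipticCurves.Kobayashi2003 ZpExtension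
  Summit.BirchSwinnertonDyer.Rank1Residual.Supersingular
  Summit.BirchSwinnertonDyer.BirchSwinnertonDyer.Theorems.SignedBaseChangeEisensteinSqueeze
  Summit.BirchSwinnertonDyer.BirchSwinnertonDyer.Theorems.SignedBaseChangeAuxiliaryCurves
  Summit.BirchSwinnertonDyer.BirchSwinnertonDyer.Theorems.SignedBaseChangeK2RTransferDescent in
/-- **S5ʳ of line «defmu» (the descent) at ANY odd prime**, the `p ≠ 2` twin of
`SemistableDefmuAssembly.kobayashiMainConjecture_of_twoVariableDvd` (p629660): PROVED modulo four PUBLISHED named facts BY NAME —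
Kobayashi 2003 Thm 1.2 `h12`, Thm 4.1 `h41`, modularity `hmod`, and Mazur 1978 Cor. 4.1 `hM` IN PLACE OF the period-unit fact (which
is typed at `5 ≤ p`): the Néron normalisation step uses `SkinnerUrban2014.exists_unit_mul_plusPeriod_of_irreducible_of_mazur` (`p ≠ 2`,
`p² ∤ N_W` from good reduction). Everything else is p629660's proof VERBATIM (`ClassX6.surj` / `.irr` hold at every odd `p`; Kato–Kobayashi
Thm 4.1 integrality under `Surj` via Wuthrich's Lemma 20). At the definite-CR datum of the line for every frame, structure map, sign and
every pair `(ξ_∘, 𝓛^∘)` with `𝓛^∘ ∣ ξ_∘` satisfying (P1)–(P3): `KobayashiMainConjecture W p ε`. CONDITIONAL; closes nothing.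
[cite: BurungaleSkinnerTianWan2024, §2.3 proof of Thm. (KoMC_r)] [cite: Kobayashi2003, Thm. 1.2, Thm. 4.1 (p. 8)] [cite: Mazur1978, Cor. 4.1] -/
theorem kobayashiMainConjecture_of_twoVariableDvd_odd
    (h12 : Kobayashi2003.thm12_signedSelmerDual_finite_torsion) (h41 : Kobayashi2003.thm41_signedCharIdeal_divisibility)
    (hmod : nonempty_modularParametrizationData) (hM : mazur_not_dvd_maninConstant_of_odd) :
    ∀ {p : ℕ} [Fact p.Prime] (ι : PadicAlgCl p ≃+* ℂ) (W : WeierstrassCurve ℚ) [W.IsElliptic]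
      [W.IsGloballyMinimal] (K : Type) [Field K] [NumberField K] (v vbar : HeightOneSpectrum (𝓞 K))
      (κ₁ κ₂ : ZpExtension K p) (γ₁ γ₂ : absoluteGaloisGroup K)
      [Fact (ZpExtension.IsTopGeneratorPair κ₁ κ₂ γ₁ γ₂)] {N : ℕ} [NeZero N] (f : CuspForm (Gamma0 N) 2)
      [NeZero (NumberField.discr K).natAbs],
      IsNewformOf W f → (N : ℤ) = W.conductorNorm ℤ → p ≠ 2 → ¬ (p : ℤ) ∣ W.conductorNorm ℤ →
      W.frobeniusTrace p = 0 →
      IsImaginaryQuadratic K → ((Ideal.span {(p : ℤ)}).primesOver (𝓞 K)).ncard = 2 →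
      ((p : ℕ) : 𝓞 K) ∈ v.asIdeal → ((p : ℕ) : 𝓞 K) ∈ vbar.asIdeal → vbar ≠ v →
      (∀ (w : InfinitePlace K) (k : 𝓞 K), k ∈ v.asIdeal ↔ ‖ι.symm (w.embedding (k : K))‖ < 1) →
      IsCoprime (N : ℤ) (NumberField.discr K) →
      Rank1Residual.ClassX6 W p →
      (∀ ρ : ModPGaloisRep K (ZMod p) 2, (W.baseChange K).IsTorsionGaloisRep p ρ →
        FramedRep.IsAbsolutelyIrreducible ρ) →
      κ₁.IsCyclotomic → κ₂.IsAnticyclotomic →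
      -- «γ₁ canonical»
      (∃ ζ : ℤ_[p]ˣ, IsOfFinOrder ζ ∧
        ((GaloisRep.cyclotomicCharacter K p γ₁ * ζ : ℤ_[p]ˣ) : ℤ_[p]) = (cyclotomicGenerator p : ℤ_[p])) →
      ∀ (Ω δ : ℂ) (Ωp : (unrIntegers p)ˣ) (LK G : PowerSeries (PowerSeries (PadicComplexInt p))),
        Ω ≠ 0 → (δ ^ 2 = (NumberField.discr K : ℂ) ∨ δ ^ 2 = -(NumberField.discr K : ℂ)) →
        IsKatzMeasure₂ ι v vbar ∅ κ₁ κ₂ γ₁⁻¹ γ₂⁻¹ 1 Ω δ ((Ωp : unrIntegers p) : PadicComplex p) LK →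
        IsGreenbergLFunctionAnyRoot₂ ι v vbar κ₁ κ₂ γ₁⁻¹ γ₂⁻¹ f (NumberField.discr K).natAbs
          (NumberField.classNumber K) LK G →
      ∀ J : ℤ_[p] →+* PadicComplexInt p,
        (∀ x : ℤ_[p], ((J x : PadicComplexInt p) : PadicComplex p) = ((x : ℚ_[p]) : PadicComplex p)) →
      ∀ ε : ℤˣ,
      ∀ xi Lsig : PowerSeries (PowerSeries (PadicComplexInt p)),
        Lsig ∣ xi →
        (Ideal.span {xi * G} =
            (WeierstrassCurve.XGr₂.charIdeal (W.baseChange K) p κ₁ κ₂ vbar γ₁ γ₂).map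
                (IwasawaAlgebra₂.toUnr₂ p J) * Ideal.span {Lsig} ∧
        ∀ (κ : ZpExtension ℚ p) (γ : absoluteGaloisGroup ℚ), κ.IsCyclotomic → κ.IsTopGenerator γ →
          IsCyclotomicVariable p γ →
          (∃ ζ : ℤ_[p]ˣ, IsOfFinOrder ζ ∧
            GaloisRep.cyclotomicCharacter ℚ p γ * ζ = GaloisRep.cyclotomicCharacter K p γ₁) →
          ∀ (W₂ : WeierstrassCurve ℚ) [W₂.IsElliptic] [W₂.IsGloballyMinimal]
            (C₂ : WeierstrassCurve.VariableChange ℚ),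
            C₂ • W₂ = W.quadraticTwist (NumberField.discr K : ℚ) →
            (∀ (D₁ : Kobayashi2003.SignedSelmerDualData W κ γ ε)
                (D₂ : Kobayashi2003.SignedSelmerDualData W₂ κ γ ε) (g₁ g₂ : IwasawaAlgebra p),
                D₁.charIdeal = Ideal.span {g₁} → D₂.charIdeal = Ideal.span {g₂} →
                UnrSeries₂.plus xi ∣ PowerSeries.map J (g₁ * g₂)) ∧
            (∀ {N₂ : ℕ} [NeZero N₂] (f₂ : CuspForm (Gamma0 N₂) 2), IsNewformOf W₂ f₂ →
              ∀ (L₁ L₂ : IwasawaAlgebra p), Kobayashi2003.IsSignedPAdicLFunction f p ε L₁ →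
                Kobayashi2003.IsSignedPAdicLFunction f₂ p ε L₂ →
                ∃ u : PowerSeries (PadicComplexInt p), IsUnit u ∧
                  UnrSeries₂.plus Lsig = u * PowerSeries.map J (L₁ * L₂))) →
        Summit.BirchSwinnertonDyer.Rank1Residual.Supersingular.KobayashiMainConjecture W p ε := by
  intro p _ ι W _ _ K _ _ v vbar κ₁ κ₂ γ₁ γ₂ _ N _ f _ hf hN hp2 hpN hap hK hsplit hv hvbar hvv
    hι hcop hX hirr hκ₁ hκ₂ hcan Ω δ Ωp LK G hΩ hδ hLK hG J hJ ε xi Ls hdvd hpkg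
  obtain ⟨hP1, hline⟩ := hpkg
  -- basics at `p` for `W` (X6 ⇒ good supersingular, `ρ̄` onto, `E[p]` irreducible)
  have hpP : p.Prime := Fact.out
  have hgood : W.HasGoodReductionAtPrime p := hX.1.1
  have hs : Surj W p := ClassX6.surj W p hp2 hX
  have hirrW : Irr W p := ClassX6.irr W p hp2 hX
  -- the auxiliary curve `W₂ ≃ W^{(D_K)}`: good at `p`, `a_p = 0`, `ρ̄` onto (`p ∤ D_K` as `p` splits)
  have hpD : ¬ (p : ℤ) ∣ NumberField.discr K := not_dvd_discr_of_ncard_primesOver_eq_two hK.1 hpP hsplit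
  have hD0 : (NumberField.discr K : ℚ) ≠ 0 := by exact_mod_cast NumberField.discr_ne_zero K
  obtain ⟨W₂, _, _, C₂, hC₂⟩ := exists_isGloballyMinimal_smul_eq_quadraticTwist W hD0
  obtain ⟨hgood₂, hap₂, hs₂⟩ :=
    goodSS_surj_of_smul_eq_quadraticTwist_discr hK.1 W W₂ p hp2 hpD hC₂ hgood hap hs
  -- levels = conductors: Kobayashi's conjecture binds the conductor-level newform, which is `f` (uniqueness)
  have hNn : N = W.conductorNorm ℤ := by exact_mod_cast hN
  subst hNn
  intro κ γ hκ hγ hγ' _ fK hfK ϖ hϖ Lp Lm hPP D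
  have hfeq : f = fK := hf.unique hfK
  subst hfeq
  -- Thm. 1.2 for `W`
  haveI hfin : Module.Finite (IwasawaAlgebra p) D.X := h12.moduleFinite hp2 hgood hap hκ hγ D
  have hXt : Module.IsTorsion (IwasawaAlgebra p) D.X := h12.isTorsion hp2 hgood hap hκ hγ D
  refine ⟨hXt, ?_⟩
  obtain ⟨g₁, hg₁⟩ := (charIdeal_isPrincipal_holds p D.X).principal
  have hg₁' : D.charIdeal = Ideal.span {g₁} := hg₁
  -- auxiliary data for `W₂`: newform (modularity), Pollack pair, Selmer datum, generator
  haveI : NeZero (W₂.conductorNorm ℤ) := ⟨(W₂.conductorNorm_pos_holds).ne'⟩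
  obtain ⟨Dm₂⟩ := hmod W₂
  obtain ⟨Lp₂, Lm₂, hPP₂⟩ :=
    exists_isPollackPair pollack_exists_plusMinusPAdicLFunction_holds hp2 Dm₂.isNewformOf hgood₂ hap₂
  obtain ⟨D₂⟩ := nonempty_signedSelmerDualData W₂ κ ε hγ
  obtain ⟨g₂, hg₂⟩ := (charIdeal_isPrincipal_holds p D₂.X).principal
  have hg₂' : D₂.charIdeal = Ideal.span {g₂} := hg₂
  -- the cyclotomic-line clauses (P2), (P3) for `(W, W₂)` at the canonical `ℚ`-variable `γ`
  have hcoord := exists_isOfFinOrder_mul_eq_of_canonical hcan hγ'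
  obtain ⟨hP2, hP3⟩ := hline κ γ hκ hγ hγ' hcoord W₂ C₂ hC₂
  have hL₁ := hPP.isSignedPAdicLFunction_kobayashiL ε
  have hL₂ := hPP₂.isSignedPAdicLFunction_kobayashiL ε
  have h2 := hP2 D D₂ g₁ g₂ hg₁' hg₂'
  obtain ⟨u, hu, h3⟩ := hP3 Dm₂.f Dm₂.isNewformOf _ _ hL₁ hL₂
  -- from the two-variable divisibility `𝓛^∘ ∣ ξ_∘`: descend through `plus` with (P2), (P3)
  have hS : PowerSeries.map J (kobayashiL ε Lp Lm * kobayashiL ε Lp₂ Lm₂) * 1 ∣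
      PowerSeries.map J (g₁ * g₂) * 1 :=
    mul_dvd_mul_of_map_of_dvd_of_eq_unit_mul
      (PowerSeries.map (PowerSeries.constantCoeff (R := PadicComplexInt p)))
      (ξ' := 1) (L' := 1) (a' := 1) (b' := 1) (u' := 1)
      (by simpa using hdvd) h2 (by simp) hu isUnit_one h3 (by simp)
  rw [mul_one, mul_one] at hS
  -- descend to `ℤ_p⟦T⟧`
  have hZ : kobayashiL ε Lp Lm * kobayashiL ε Lp₂ Lm₂ ∣ g₁ * g₂ :=
    Summit.BirchSwinnertonDyer.BirchSwinnertonDyer.Theorems.SignedBaseChangeK2RDivisibilityDescent.iwasawaAlgebra_dvd_of_map_dvd_map_padicComplexInt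
      hJ hS
  -- Kobayashi Thm. 4.1 (integral under `Surj`) for `W` and `W₂`
  have hL20 := Wuthrich2014.lemma20_surjective_threeAdic_of_semistable_holds
  have hK₁ : g₁ ∣ kobayashiL ε Lp Lm :=
    h41.dvd_of_charIdeal_eq_span hp2 hgood hap hfK hκ hγ hγ' hL₁ D hXt
      (surjective_pow_of_surj_of_good W p hL20 hp2 hgood hs) hg₁'
  haveI : Module.Finite (IwasawaAlgebra p) D₂.X := h12.moduleFinite hp2 hgood₂ hap₂ hκ hγ D₂
  have hK₂ : g₂ ∣ kobayashiL ε Lp₂ Lm₂ :=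
    h41.dvd_of_charIdeal_eq_span hp2 hgood₂ hap₂ Dm₂.isNewformOf hκ hγ hγ' hL₂ D₂
      (h12.isTorsion hp2 hgood₂ hap₂ hκ hγ D₂) (surjective_pow_of_surj_of_good W₂ p hL20 hp2 hgood₂ hs₂) hg₂'
  -- two-factor squeeze: `(g₁) = (L^ε(f))`
  have hassoc₁ : Associated g₁ (kobayashiL ε Lp Lm) :=
    associated_of_dvd_of_mul4_dvd (g₃ := 1) (g₄ := 1) (L₃ := 1) (L₄ := 1) hK₁ hK₂ (dvd_refl 1) (dvd_refl 1)
      (kobayashiL_ne_zero hPP ε) (kobayashiL_ne_zero hPP₂ ε) one_ne_zero one_ne_zero (by simpa using hZ)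
  have hchar : D.charIdeal = Ideal.span {kobayashiL ε Lp Lm} := by
    rw [hg₁']; exact Ideal.span_singleton_eq_span_singleton.mpr hassoc₁
  -- Néron normalisation: `ϖ` is a `p`-adic unit
  set L := kobayashiL ε Lp Lm with hL_def
  have hvϖ : padicValRat p ϖ = 0 := by
    -- Mazur 1978 Cor. 4.1 BY NAME (`hM`): the Manin constant is a unit at the odd good prime `p` (`p² ∤ N_W`)
    have hp2N : ¬ p ^ 2 ∣ W.conductorNorm ℤ := fun h =>
      hpN (by exact_mod_cast (dvd_trans (dvd_pow_self p two_ne_zero) h))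
    obtain ⟨u, hu, hΩ⟩ := SkinnerUrban2014.exists_unit_mul_plusPeriod_of_irreducible_of_mazur hM W p hp2 hirrW _ hfK hp2N
    exact padicValRat_periodRatio_eq_zero_of_eq_unit_mul W p _ hu hΩ ϖ hϖ
  have hϖ0 : ϖ ≠ 0 := by
    intro hz
    rw [hz, Rat.cast_zero, zero_mul] at hϖ
    exact (IsNewform0.plusPeriod_pos_holds hfK.1 hfK.coeffField_eq_bot).ne' hϖ.symm
  obtain ⟨u₁, hu₁⟩ := exists_units_coe_eq_ratCast hϖ0 hvϖ
  obtain ⟨hspan', hι'⟩ := span_C_units_mul_eq u₁ L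
  refine ⟨PowerSeries.C (u₁ : ℤ_[p]) * L, ?_, ?_⟩
  · rw [hchar, hspan']
  · rw [hι', hu₁]

/-! ### §3. The package ⟹ the lower divisibility, at any odd prime with `a_p = 0` -/

/-- **The ODD-prime form of the `5 ≤ p` assembly of crux 2** (twin of `SemistableDefmuAssembly.exists_kobayashiLowerDivisibility_of_package`,
p629660, with every `5 ≤ p` replaced by `p ≠ 2` plus the explicit supersingularity `a_p = 0`): from S1aʳ at odd `p` (`h1a`), the package Cμ
at odd `p` (`hC`: the BSTW signed two-variable package at the definite-CR datum WITH unit content on the anticyclotomic line), BSTW Thm 6.17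
AT ODD `p` as a DISPLAYED HYPOTHESIS (`h617`: the text of the tree's binder `thm617_exists_isGreenbergLFunctionAnyRoot₂_supersingular_PRE` with
its `5 ≤ p` replaced by `p ≠ 2` — print states Thm 6.17 for `p ∤ 2N` with (h4) `a_p = 0` at `p = 3`; the tree's binder is typed at `5 ≤ p`,
so at `p = 3` this is an UNTYPED PREPRINT CLAIM, and it is exactly where the cell's referees located the `p = 3` residual (3-ii)♭′
(bstw-MEMO-10); it is NOT asserted here), Kobayashi Thms 1.2 / 4.1, modularity, Mazur Cor. 4.1 (`hM`, replacing the `5 ≤ p` period-unit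
fact) and GMC_r = BSTW Thm 9.24 (`h924`, typed at `p ≠ 2`): for every globally minimal `W/ℚ` and odd prime `p` with `ClassX6 W p` and
`a_p(W) = 0`, `∃ ε, KobayashiLowerDivisibility W p ε`. Proof = p629660 §3 VERBATIM with `definiteFieldSupplyFromR_odd` and
`kobayashiMainConjecture_of_twoVariableDvd_odd`. CONDITIONAL on the displayed hypotheses (`conditional-result`); closes nothing; the item
stays OPEN. [claim: BurungaleSkinnerTianWan2024, status: under-review] [cite: BurungaleSkinnerTianWan2024, §2.3 proof of Thm. (KoMC_r), Thm. 6.17, Thm. 9.24]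
[cite: Kobayashi2003, Conjecture (Main Conjecture) (p. 2), Thm. 1.2, Thm. 4.1] [cite: Mazur1978, Cor. 4.1] -/
theorem exists_kobayashiLowerDivisibility_odd_of_package
    (h1a :
      ∀ (p : ℕ) [Fact p.Prime] (W : WeierstrassCurve ℚ) [W.IsElliptic] [W.IsGloballyMinimal],
        p ≠ 2 → Rank1Residual.ClassX6 W p →
        ∃ q₀ : ℕ, q₀.Prime ∧ (q₀ : ℤ) ∣ W.conductorNorm ℤ ∧ ¬ ((p : ℤ) ∣ padicValRat q₀ W.Δ))
    (hC :
      ∀ {p : ℕ} [Fact p.Prime] (ι : PadicAlgCl p ≃+* ℂ) (W : WeierstrassCurve ℚ) [W.IsElliptic]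
        [W.IsGloballyMinimal] (K : Type) [Field K] [NumberField K] (v vbar : HeightOneSpectrum (𝓞 K))
        (κ₁ κ₂ : ZpExtension K p) (γ₁ γ₂ : absoluteGaloisGroup K)
        [Fact (ZpExtension.IsTopGeneratorPair κ₁ κ₂ γ₁ γ₂)] {N : ℕ} [NeZero N] (f : CuspForm (Gamma0 N) 2)
        [NeZero (NumberField.discr K).natAbs],
        IsNewformOf W f → (N : ℤ) = W.conductorNorm ℤ → p ≠ 2 → ¬ (p : ℤ) ∣ W.conductorNorm ℤ →
        W.frobeniusTrace p = 0 →
        IsImaginaryQuadratic K → ((Ideal.span {(p : ℤ)}).primesOver (𝓞 K)).ncard = 2 →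
        ((p : ℕ) : 𝓞 K) ∈ v.asIdeal → ((p : ℕ) : 𝓞 K) ∈ vbar.asIdeal → vbar ≠ v →
        (∀ (w : InfinitePlace K) (k : 𝓞 K), k ∈ v.asIdeal ↔ ‖ι.symm (w.embedding (k : K))‖ < 1) →
        IsCoprime (N : ℤ) (NumberField.discr K) →
        -- ⟨definite-CR datum at an ODD prime: X6; ONE prime q₀ ∥ N inert in K, every other ℓ ∣ N split; `2` split or
        --  `2 ∣ N` ((spl) of BSTW Thm 9.24); (CR, RAMIFIED branch only) `p ∤ v_{q₀}(Δ_W)` (ρ̄ ramified at q₀, `p ∤ c_{q₀}`)⟩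
        Rank1Residual.ClassX6 W p →
        ∀ q₀ : ℕ, q₀.Prime → q₀ ∣ N → ¬ (q₀ ^ 2 ∣ N) →
          ((Ideal.span {(q₀ : ℤ)}).primesOver (𝓞 K)).ncard = 1 →
          (∀ ℓ : ℕ, ℓ.Prime → ℓ ∣ N → ℓ ≠ q₀ → ((Ideal.span {(ℓ : ℤ)}).primesOver (𝓞 K)).ncard = 2) →
          (((Ideal.span {(2 : ℤ)}).primesOver (𝓞 K)).ncard = 2 ∨ 2 ∣ N) →
          ¬ ((p : ℤ) ∣ padicValRat q₀ W.Δ) →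
        (∀ ρ : ModPGaloisRep K (ZMod p) 2, (W.baseChange K).IsTorsionGaloisRep p ρ →
          FramedRep.IsAbsolutelyIrreducible ρ) →
        κ₁.IsCyclotomic → κ₂.IsAnticyclotomic →
        ∀ (Ω δ : ℂ) (Ωp : (unrIntegers p)ˣ) (LK G : PowerSeries (PowerSeries (PadicComplexInt p))),
          Ω ≠ 0 → (δ ^ 2 = (NumberField.discr K : ℂ) ∨ δ ^ 2 = -(NumberField.discr K : ℂ)) →
          IsKatzMeasure₂ ι v vbar ∅ κ₁ κ₂ γ₁⁻¹ γ₂⁻¹ 1 Ω δ ((Ωp : unrIntegers p) : PadicComplex p) LK →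
          IsGreenbergLFunctionAnyRoot₂ ι v vbar κ₁ κ₂ γ₁⁻¹ γ₂⁻¹ f (NumberField.discr K).natAbs
            (NumberField.classNumber K) LK G →
        ∀ J : ℤ_[p] →+* PadicComplexInt p,
          (∀ x : ℤ_[p], ((J x : PadicComplexInt p) : PadicComplex p) = ((x : ℚ_[p]) : PadicComplex p)) →
        ∀ ε : ℤˣ,
        ∃ xi Lsig : PowerSeries (PowerSeries (PadicComplexInt p)),
          GreenbergVatsal2000.HasUnitContent (UnrSeries₂.minus Lsig) ∧
          (Ideal.span {xi * G} =
              (WeierstrassCurve.XGr₂.charIdeal (W.baseChange K) p κ₁ κ₂ vbar γ₁ γ₂).map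
                  (IwasawaAlgebra₂.toUnr₂ p J) * Ideal.span {Lsig} ∧
          ∀ (κ : ZpExtension ℚ p) (γ : absoluteGaloisGroup ℚ), κ.IsCyclotomic → κ.IsTopGenerator γ →
            IsCyclotomicVariable p γ →
            (∃ ζ : ℤ_[p]ˣ, IsOfFinOrder ζ ∧
              GaloisRep.cyclotomicCharacter ℚ p γ * ζ = GaloisRep.cyclotomicCharacter K p γ₁) →
            ∀ (W₂ : WeierstrassCurve ℚ) [W₂.IsElliptic] [W₂.IsGloballyMinimal]
              (C₂ : WeierstrassCurve.VariableChange ℚ),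
              C₂ • W₂ = W.quadraticTwist (NumberField.discr K : ℚ) →
              (∀ (D₁ : Kobayashi2003.SignedSelmerDualData W κ γ ε)
                  (D₂ : Kobayashi2003.SignedSelmerDualData W₂ κ γ ε) (g₁ g₂ : IwasawaAlgebra p),
                  D₁.charIdeal = Ideal.span {g₁} → D₂.charIdeal = Ideal.span {g₂} →
                  UnrSeries₂.plus xi ∣ PowerSeries.map J (g₁ * g₂)) ∧
              (∀ {N₂ : ℕ} [NeZero N₂] (f₂ : CuspForm (Gamma0 N₂) 2), IsNewformOf W₂ f₂ →
                ∀ (L₁ L₂ : IwasawaAlgebra p), Kobayashi2003.IsSignedPAdicLFunction f p ε L₁ →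
                  Kobayashi2003.IsSignedPAdicLFunction f₂ p ε L₂ →
                  ∃ u : PowerSeries (PadicComplexInt p), IsUnit u ∧
                    UnrSeries₂.plus Lsig = u * PowerSeries.map J (L₁ * L₂))))
    (h617 :
    ∀ {p : ℕ} [Fact p.Prime] (ι : PadicAlgCl p ≃+* ℂ) (W : WeierstrassCurve ℚ) [W.IsElliptic]
      [W.IsGloballyMinimal] (K : Type) [Field K] [NumberField K] (v vbar : HeightOneSpectrum (𝓞 K))
      (κ₁ κ₂ : ZpExtension K p) (γ₁ γ₂ : absoluteGaloisGroup K)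
      [Fact (ZpExtension.IsTopGeneratorPair κ₁ κ₂ γ₁ γ₂)] {N : ℕ} [NeZero N] {f : CuspForm (Gamma0 N) 2}
      (_ : IsNewformOf W f) [NeZero (NumberField.discr K).natAbs],
      -- `g = f_E` of level `N = N_E`; `p` ODD of good SUPERSINGULAR reduction: `p ∤ N_E`, `a_p(E) = 0`
      (N : ℤ) = W.conductorNorm ℤ → p ≠ 2 → ¬ (p : ℤ) ∣ W.conductorNorm ℤ → W.frobeniusTrace p = 0 →
      -- `L = K` imaginary quadratic; (h2) `p = v v̄` split, `v` induced by `ι`; (h1) `(N, D_K) = 1`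
      IsImaginaryQuadratic K → ((Ideal.span {(p : ℤ)}).primesOver (𝓞 K)).ncard = 2 →
      ((p : ℕ) : 𝓞 K) ∈ v.asIdeal → ((p : ℕ) : 𝓞 K) ∈ vbar.asIdeal → vbar ≠ v →
      (∀ (w : InfinitePlace K) (k : 𝓞 K), k ∈ v.asIdeal ↔ ‖ι.symm (w.embedding (k : K))‖ < 1) →
      IsCoprime (N : ℤ) (NumberField.discr K) →
      -- the `ℤ_p²`-tower: `κ₁` cyclotomic, `κ₂` anticyclotomic, generator pair `(γ₁, γ₂)`
      κ₁.IsCyclotomic → κ₂.IsAnticyclotomic →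
      -- a Katz frame (period data + Katz's two-variable measure) and `G = 𝓛_p^Gr(f/K)` in it
      ∃ (Ω δ : ℂ) (Ωp : (unrIntegers p)ˣ) (LK G : PowerSeries (PowerSeries (PadicComplexInt p))),
        Ω ≠ 0 ∧ (δ ^ 2 = (NumberField.discr K : ℂ) ∨ δ ^ 2 = -(NumberField.discr K : ℂ)) ∧
        IsKatzMeasure₂ ι v vbar ∅ κ₁ κ₂ γ₁⁻¹ γ₂⁻¹ 1 Ω δ ((Ωp : unrIntegers p) : ℂ_[p]) LK ∧
        IsGreenbergLFunctionAnyRoot₂ ι v vbar κ₁ κ₂ γ₁⁻¹ γ₂⁻¹ f (NumberField.discr K).natAbs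
          (NumberField.classNumber K) LK G)
    (h12 : Kobayashi2003.thm12_signedSelmerDual_finite_torsion)
    (h41 : Kobayashi2003.thm41_signedCharIdeal_divisibility)
    (hmod : nonempty_modularParametrizationData)
    (hM : mazur_not_dvd_maninConstant_of_odd)
    (h924 : thm924_greenberg_dvd_charIdealXGr₂_awayFromCyc_OPEN)
    (W : WeierstrassCurve ℚ) [W.IsElliptic] [W.IsGloballyMinimal] (p : ℕ) [Fact p.Prime]
    (hp : p ≠ 2) (hX : Rank1Residual.ClassX6 W p) (ha0 : W.frobeniusTrace p = 0) :
    ∃ ε : ℤˣ, Summit.BirchSwinnertonDyer.Rank1Residual.Supersingular.KobayashiLowerDivisibility W p ε := by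
  haveI : NeZero (W.conductorNorm ℤ) := ⟨(W.conductorNorm_pos_holds).ne'⟩
  obtain ⟨π⟩ := hmod W
  -- the local facts at `p` read off the class, and square-freeness of `N_W` from semistability
  have hgood : W.HasGoodReductionAtPrime p := hX.1.1
  have hpN' : ¬ p ∣ W.conductorNorm ℤ := not_dvd_conductorNorm_of_hasGoodReductionAtPrime W hgood
  have hpN : ¬ (p : ℤ) ∣ W.conductorNorm ℤ := by exact_mod_cast hpN'
  have hN : ((W.conductorNorm ℤ : ℕ) : ℤ) = W.conductorNorm ℤ := rfl
  have hsq : Squarefree (W.conductorNorm ℤ) :=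
    (W.isSemistable_iff_squarefree_conductorNorm).mp ((Rank1Residual.semistable_iff_isSemistable_int W).mp hX.2.1)
  -- S1aʳ: the ramified level prime; S1bʳ: the definite datum with this `q₀` inert
  obtain ⟨q₀, hq₀, hqN, hCR⟩ := h1a p W hp hX
  obtain ⟨K, _, _, ι, v, vbar, κ₁, κ₂, γ₁, γ₂, _, _, hIQ, hsp, hv, hvbar, hvv, hι, hcop, hq₀', hqN', hq2, hin, hspl,
    h2K, hCR', hirr, hκ₁, hκ₂, hcan⟩ := definiteFieldSupplyFromR_odd p W (W.conductorNorm ℤ) hN hp hX q₀ hq₀ hqN hCR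
  -- a Katz/Greenberg frame for `π.f` over `K`, and a structure map `J`
  obtain ⟨Ω, δ, Ωp, LK, G, hΩ, hδ, hLK, hGr⟩ :=
    h617 ι W K v vbar κ₁ κ₂ γ₁ γ₂ π.isNewformOf hN hp hpN ha0 hIQ hsp hv hvbar hvv hι hcop hκ₁ hκ₂
  obtain ⟨J, hJ⟩ := exists_structureMap_padicInt (p := p)
  refine ⟨1, Summit.BirchSwinnertonDyer.Rank1Residual.Supersingular.kobayashiLowerDivisibility_of_mainConjecture ?_⟩
  -- Cμ: the package with unit content on the anticyclotomic line, for `ε = 1`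
  obtain ⟨xi, Lsig, hμ, hP1, hline⟩ := hC ι W K v vbar κ₁ κ₂ γ₁ γ₂ π.f π.isNewformOf hN hp hpN ha0 hIQ hsp hv hvbar
    hvv hι hcop hX q₀ hq₀' hqN' hq2 hin hspl h2K hCR' hirr hκ₁ hκ₂ Ω δ Ωp LK G hΩ hδ hLK hGr J hJ 1
  -- GMC_r (BSTW Thm 9.24, BY NAME): the cyclotomic-variable witness `s`; (spl) from `q₀` inert
  obtain ⟨s, hs, hle⟩ := h924 ι W K v vbar κ₁ κ₂ γ₁ γ₂ π.isNewformOf hN hsq hp hpN' hIQ hsp hv hvbar hvv hι hcop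
    hirr ⟨q₀, hq₀', hqN', by rw [hin]; decide⟩ h2K hκ₁ hκ₂ Ω δ Ωp LK G hΩ hδ hLK hGr J hJ
  -- `G ≠ 0` is free: (P1), `ch ≠ ⊥`, `𝓛^∘ ≠ 0`
  have hLs : Lsig ≠ 0 := ne_zero_of_hasUnitContent_minus hμ
  have hG0 : G ≠ 0 :=
    ne_zero_of_span_mul_eq hP1 (map_charIdealXGr₂_ne_bot _ κ₁ κ₂ vbar γ₁ γ₂ (structureMap_injective hJ)) hLs
  -- the μ-transfer: `𝓛^∘ ∣ ξ_∘` two-variably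
  have hdvd : Lsig ∣ xi := dvd_of_awayFromCyc_of_package hμ hs hle hP1 hG0
  -- S5ʳ: descend and squeeze
  exact kobayashiMainConjecture_of_twoVariableDvd_odd h12 h41 hmod hM ι W K v vbar κ₁ κ₂ γ₁ γ₂ π.f π.isNewformOf hN hp hpN ha0 hIQ hsp hv
    hvbar hvv hι hcop hX hirr hκ₁ hκ₂ hcan Ω δ Ωp LK G hΩ hδ hLK hGr J hJ 1 xi Lsig hdvd ⟨hP1, hline⟩

end Summit.BirchSwinnertonDyer.BirchSwinnertonDyer.Theorems.SemistableDefmuOddPrime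

end
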